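import Mathlib.Algebra.Module.Injective
import Mathlib.RingTheory.PrincipalIdealDomain
import Mathlib.RingTheory.Ideal.Quotient.Operations
import Mathlib.Algebra.Module.Torsion.Basic
import HarnessLib

/-!
# `A/(a)` is self-injective for a principal ideal domain `A`; pure extensions split modulo `a`

Topic `RingTheory/DiscreteValuationRing`; namespace `Literature.RingTheory.DiscreteValuationRing`.
Theorems only (Mathlib-only imports; no definition, no named fact, no instance, no `sorry`).

For a principal ideal domain `A` and `a ≠ 0`, the Artinian principal ideal ring `R = A/(a)` is a
Frobenius (quasi-Frobenius) ring, in particular SELF-INJECTIVE: Baer's criterion is immediate since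
the ideals of `R` are the `(d)/(a)`, `d ∣ a`, and an `R`-linear `g : (d)/(a) → R` has `g(d̄) = d̄ ȳ`
(`baer_quotient_span_singleton`; [Lam1999, §15, Example 15.27 / Exercise: `ℤ/nℤ` and more generally
`A/(a)` for a PID `A` are self-injective]).  Consequences:

* `exists_retraction_of_injective` — every injective `R`-linear `R → X` has an `R`-linear
  retraction (`Module.Baer.extension_property`);
* `exists_retraction_quotient_algebraMap` — for an `A`-algebra `B` in which `a` is PURE
  (`a ∣ x` in `B` for `x ∈ A` implies `a ∣ x` in `A`), the map `A/(a) → B/(a)` admits an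
  `A`-linear retraction.  (Use in the tree: `𝒪_{E'}/p^t ↪ ℤ̄_p/p^t` splits `𝒪_{E'}`-linearly, so
  cohomology with `𝒪_{E'}/p^t`-coefficients injects into cohomology with `ℤ̄_p/p^t`-coefficients —
  the passage from a Noetherian coefficient ring to `ℤ̄_p` in [Scholze2015, §V.4].)

## References

* T. Y. Lam, *Lectures on Modules and Rings*, GTM 189 (1999), §3B (Baer's criterion), §15
  (quasi-Frobenius rings; `ℤ/nℤ`, `k[x]/(f)` and quotients of PIDs are self-injective). [Lam1999]
* P. Scholze, Ann. of Math. 182 (2015), §V.4. [Scholze2015]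
-/

namespace Literature.RingTheory.DiscreteValuationRing

variable {A : Type*} [CommRing A] [IsDomain A] [IsPrincipalIdealRing A]

/-- **`A/(a)` satisfies Baer's criterion over itself** (`A` a PID, `a ≠ 0`): every linear map from
an ideal of `A/(a)` to `A/(a)` extends to `A/(a)`. [cite: Lam1999, §15 (quotients of PIDs are
self-injective)] -/
theorem baer_quotient_span_singleton {a : A} (ha : a ≠ 0) :
    Module.Baer (A ⧸ Ideal.span ({a} : Set A)) (A ⧸ Ideal.span ({a} : Set A)) := by
  classical
  intro I g
  set R := A ⧸ Ideal.span ({a} : Set A)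
  -- the ideal `I` is `(d)/(a)` with `d ∣ a`
  let I' : Ideal A := I.comap (Ideal.Quotient.mk (Ideal.span {a}))
  obtain ⟨d, hd⟩ : ∃ d : A, I' = Ideal.span {d} :=
    ⟨Submodule.IsPrincipal.generator I', (Submodule.IsPrincipal.span_singleton_generator I').symm⟩
  have haI' : a ∈ I' := by
    change Ideal.Quotient.mk (Ideal.span {a}) a ∈ I
    rw [Ideal.Quotient.eq_zero_iff_mem.2 (Ideal.mem_span_singleton_self a)]
    exact I.zero_mem
  obtain ⟨e, he⟩ : d ∣ a := by
    rw [← Ideal.mem_span_singleton, ← hd]; exact haI'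
  have he0 : e ≠ 0 := by rintro rfl; exact ha (by rw [he, mul_zero])
  have hdI : Ideal.Quotient.mk (Ideal.span {a}) d ∈ I := by
    change d ∈ I'
    rw [hd]; exact Ideal.mem_span_singleton_self d
  -- `g(d̄) = x̄` with `d ∣ x`
  obtain ⟨x, hx⟩ := Ideal.Quotient.mk_surjective (g ⟨_, hdI⟩)
  have hex : Ideal.Quotient.mk (Ideal.span {a}) (e * x) = 0 := by
    have h1 : (Ideal.Quotient.mk (Ideal.span {a}) e) • g ⟨_, hdI⟩ =
        g ((Ideal.Quotient.mk (Ideal.span {a}) e) • ⟨_, hdI⟩) := (map_smul g _ _).symm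
    have h2 : (Ideal.Quotient.mk (Ideal.span {a}) e) • (⟨_, hdI⟩ : I) = 0 := by
      refine Subtype.ext ?_
      change Ideal.Quotient.mk (Ideal.span {a}) e * Ideal.Quotient.mk (Ideal.span {a}) d = 0
      rw [← map_mul, mul_comm, ← he]
      exact Ideal.Quotient.eq_zero_iff_mem.2 (Ideal.mem_span_singleton_self a)
    rw [h2, map_zero, ← hx, smul_eq_mul, ← map_mul] at h1
    exact h1
  obtain ⟨y, hy⟩ : d ∣ x := by
    have h := Ideal.Quotient.eq_zero_iff_mem.1 hex
    rw [Ideal.mem_span_singleton, he] at h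
    obtain ⟨c, hc⟩ := h
    refine ⟨c, mul_left_cancel₀ he0 ?_⟩
    rw [hc]; ring
  -- extend by `1 ↦ ȳ`
  refine ⟨LinearMap.toSpanSingleton R R (Ideal.Quotient.mk (Ideal.span {a}) y), fun z hz => ?_⟩
  obtain ⟨w, rfl⟩ := Ideal.Quotient.mk_surjective z
  have hw : w ∈ I' := hz
  rw [hd, Ideal.mem_span_singleton] at hw
  obtain ⟨c, rfl⟩ := hw
  rw [LinearMap.toSpanSingleton_apply, smul_eq_mul, ← map_mul,
    show d * c * y = c * x by rw [hy]; ring, map_mul]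
  have hmem : (⟨Ideal.Quotient.mk (Ideal.span {a}) (d * c), hz⟩ : I) =
      (Ideal.Quotient.mk (Ideal.span {a}) c) • (⟨_, hdI⟩ : I) :=
    Subtype.ext (by
      change Ideal.Quotient.mk (Ideal.span {a}) (d * c) =
        Ideal.Quotient.mk (Ideal.span {a}) c * Ideal.Quotient.mk (Ideal.span {a}) d
      rw [← map_mul, mul_comm])
  rw [hmem, map_smul, ← hx, smul_eq_mul]

/-- **`A/(a)` is self-injective**: an injective `A/(a)`-linear map `A/(a) → X` has a retraction.
[cite: Lam1999, §3B (Baer's criterion) and §15] -/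
theorem exists_retraction_of_injective {a : A} (ha : a ≠ 0) {X : Type*} [AddCommGroup X]
    [Module (A ⧸ Ideal.span ({a} : Set A)) X]
    (f : (A ⧸ Ideal.span ({a} : Set A)) →ₗ[A ⧸ Ideal.span ({a} : Set A)] X)
    (hf : Function.Injective f) :
    ∃ r : X →ₗ[A ⧸ Ideal.span ({a} : Set A)] (A ⧸ Ideal.span ({a} : Set A)), r ∘ₗ f = LinearMap.id :=
  (baer_quotient_span_singleton ha).extension_property f hf LinearMap.id

/-- **A pure extension splits modulo `a`.**  Let `B` be a commutative `A`-algebra in which `a ≠ 0`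
is pure: whenever `algebraMap A B x` is a multiple of `algebraMap A B a`, already `a ∣ x` in `A`.
Then `A/(a) → B/(a)` has an `A`-linear retraction `r` (`r (x̄) = x̄` for `x ∈ A`).
[cite: Lam1999, §15] [cite: Scholze2015, §V.4 (proof of Thm. V.4.1)] -/
theorem exists_retraction_quotient_algebraMap {a : A} (ha : a ≠ 0) (B : Type*) [CommRing B]
    [Algebra A B]
    (hpure : ∀ x : A, (∃ y : B, algebraMap A B x = y * algebraMap A B a) → a ∣ x) :
    ∃ r : (B ⧸ Ideal.span ({algebraMap A B a} : Set B)) →ₗ[A] (A ⧸ Ideal.span ({a} : Set A)),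
      ∀ x : A, r (Ideal.Quotient.mk _ (algebraMap A B x)) = Ideal.Quotient.mk _ x := by
  classical
  set J : Ideal B := Ideal.span ({algebraMap A B a} : Set B)
  set X := B ⧸ J
  -- `X` is killed by `a`, hence a module over `R = A/(a)`
  have hX : Module.IsTorsionBySet A X (Ideal.span ({a} : Set A)) := by
    rw [Module.isTorsionBySet_span_singleton_iff]
    intro z
    obtain ⟨b, rfl⟩ := Ideal.Quotient.mk_surjective z
    change a • Ideal.Quotient.mk J b = 0
    rw [Algebra.smul_def, IsScalarTower.algebraMap_apply A B (B ⧸ J), Ideal.Quotient.algebraMap_eq,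
      ← map_mul, Ideal.Quotient.eq_zero_iff_mem]
    exact Ideal.mul_mem_right _ _ (Ideal.subset_span rfl)
  letI := hX.module
  set R := A ⧸ Ideal.span ({a} : Set A)
  have hsmul : ∀ (c : A) (z : X), (Ideal.Quotient.mk (Ideal.span {a}) c) • z = c • z :=
    fun c z => Module.IsTorsionBySet.mk_smul hX c z
  -- the structure map `R → X`, `r ↦ r • 1`
  let f : R →ₗ[R] X := LinearMap.toSpanSingleton R X 1
  have hf1 : ∀ x : A, f (Ideal.Quotient.mk _ x) = Ideal.Quotient.mk J (algebraMap A B x) := by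
    intro x
    change (Ideal.Quotient.mk (Ideal.span {a}) x) • (1 : X) = _
    rw [hsmul, Algebra.smul_def, mul_one]
    rfl
  have hf : Function.Injective f := by
    rw [← LinearMap.ker_eq_bot, Submodule.eq_bot_iff]
    intro z hz
    obtain ⟨x, rfl⟩ := Ideal.Quotient.mk_surjective z
    rw [LinearMap.mem_ker, hf1, Ideal.Quotient.eq_zero_iff_mem, Ideal.mem_span_singleton'] at hz
    obtain ⟨y, hy⟩ := hz
    exact Ideal.Quotient.eq_zero_iff_mem.2 (Ideal.mem_span_singleton.2 (hpure x ⟨y, hy.symm⟩))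
  obtain ⟨h, hh⟩ := exists_retraction_of_injective ha f hf
  refine ⟨{ toFun := h, map_add' := map_add h, map_smul' := fun c z => ?_ }, fun x => ?_⟩
  · rw [← hsmul, map_smul h, RingHom.id_apply]
    rfl
  · have := LinearMap.congr_fun hh (Ideal.Quotient.mk _ x)
    rw [LinearMap.comp_apply, hf1, LinearMap.id_apply] at this
    exact this

end Literature.RingTheory.DiscreteValuationRing
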